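import Mathlib
import Summits.Ventures.HodgeRepro.Tier4.Line4.TailGlueRatio
import Summits.Ventures.HodgeRepro.Tier4.Line4.RatioBridge
import Summits.Ventures.HodgeRepro.Tier4.Line4.TransporterSeparation
import Summits.Ventures.HodgeRepro.Tier4.Line4.SuppMeasureFinite
import Summits.Ventures.HodgeRepro.Tier4.Line4.OrbitProper
import Summits.Ventures.HodgeRepro.Tier4.Line4.UnitBeta
import Summits.Ventures.HodgeRepro.Tier4.Line4.CentreFinSeesaw
import Summits.Ventures.HodgeRepro.Tier4.Line4.SeesawDistribution
import Summits.Ventures.HodgeRepro.Tier4.Line1.DefinedContentOfData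
import Summits.Ventures.HodgeRepro.Tier4.Line4.ArchApproxGlue
import Summits.Ventures.HodgeRepro.Tier4.Common.CompactUnimodular
import Summits.Ventures.HodgeRepro.Tier4.Line4.TailSeesawSparse
import Summits.Ventures.HodgeRepro.Tier4.Line4.FinNVInstance
import Summits.Ventures.HodgeRepro.Tier4.Line4.ArchBallMixed
import Summits.Ventures.HodgeRepro.Tier4.Line4.ArchBallReduce
import Summits.Ventures.HodgeRepro.Tier4.Line4.SublevelOfVolume
import Summits.Ventures.HodgeRepro.Tier4.Line4.SublevelCountGlue
import Summits.Ventures.HodgeRepro.Tier4.Line4.SeesawSigns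
import Summits.Ventures.HodgeRepro.Tier4.Line4.ChainInputsWitness
import Summits.Ventures.HodgeRepro.Tier4.Line4.ConvInfRegularity
import Summits.Ventures.HodgeRepro.Tier4.Line4.ChainInputsFin
import Summits.Ventures.HodgeRepro.Tier4.Line4.ChainInputsFin2
import Summits.Ventures.HodgeRepro.Tier4.Line4.KTypeDataSeesaw
import Summits.Ventures.HodgeRepro.Tier4.Line4.TorusMeasurableMul

/-!
# Tier4/Line4/TailSeesawRatio — C-L4-7B-ASSEMBLY at the plane of record with (S-RATIO) BY NAME: the (7b) display body
with the (F) pieces `u κ hκ hproj M₃ hM₃ hcur` REPLACED by the product Haar split of `νf` at `placesAbove p` — the ratio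
display `hratio` of TailGlueMain is L1-p4's `exists_hratio_of_ratioFinal` (RatioBridge), and the level shift `n₁` of the
assembly is taken ≥ its threshold `c₀ + 1`

Blind re-derivation cell `pub-hodge-repro`, Tier 4 «prove the step» (README §9–§10), seat t4-L2-p2 (gen 6; L1-p4 g5's
S16141 «the consumption is YOURS — the name to bind in TailSeesawChain v4 / `TailSeesawRatio`»).  Tree path
`lean/Summits/Ventures/HodgeRepro/Tier4/Line4/TailSeesawRatio.lean`.  Mathlib-level; no literature; no `def`.

TWO THEOREMS.
* **`exists_levelFamily_fibreDominated_of_ratio`** (any plane `W`): x2's generic layer `exists_levelFamily_fibreDominated_of_pieces`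
  (TailPieces) with the (F) pieces `u κ hκ hproj v M₃ hM₃ hcur M₄ hM₄ hβ` REPLACED by RatioBridge's data — the plane-structure
  clauses `hΩ hd hΩB hPB hQB hPr hQr` (the conjuncts of `IsGenuineRow`), the product Haar split `νS νA cq hcq` of `νf` at
  `placesAbove p` and the CM input `hZ : CentreFinFinite W` — and the separation threshold `n₁` chosen INSIDE as the larger of
  (S-SEP)'s `n₁'` (`exists_level_separates_transporter`) and RatioBridge's `c₀ + 1`; the ratio display `(C', hC', hratio)` of
  TailGlueMain's `exists_levelFamily_fibreDominated_of_displays_main` is then RatioBridge's verbatim, everything else re-indexed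
  exactly as in TailPieces (`hff`, `hg'`, `hR'`, `hnv'`, `hchain'`).
* **`tailForArch_seesaw_of_ratio`** (the plane of record `(mixedRow q (a 0) (a 2)).withTransportedTorus g g' hgg' hg'g hgΩ`):
  `tailForArch_seesaw_of_pieces_chain` (TailSeesawChain v3) with `u κ hκ hproj M₃ hM₃ hcur` REPLACED by `νS [IsHaar] cq hcq`
  (`νA` is the away measure already bound, the one of `haway`) — every other binder and the conclusion token-identical — and
  the WHOLE stack re-assembled on the generic layer above, every plane fact by name: `hgen` (`isGenuineRow_seesawPlane`),
  `hdet` (`mixedRow_withTransportedTorus_isHermitianRow`), `hΩ … hQr` (the conjuncts of `hgen`), `hreg`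
  (`isRegularRational_of_isLinRegular`), `hZ` (`centreFinFinite_of_compactSpace_torusInf`), PROPER
  (`hasProperFinOrbit_of_isLinRegular`), the unit positivity `hv` (UnitBeta's `suppMeasure_toReal_pos_of_beta` at the product
  domain), the archimedean test `e` (ARCHAPPROX through `D := kTypeData_seesaw … hchi hchi'`), (S-SPARSE)
  (`exists_sparsityScale_plain`), (S-COUNT) `hcount` from the sign data (ArchBallMixed ∘ ArchBallReduce ∘ SublevelOfVolume),
  `ChainInputs` at the witness (`chainInputs_witness_of_pieces` with the ARCH / FIN / (B1) clauses by name), (S-FIN-NV) in norm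
  form (`finnv_of_displays'`), the `MeasurableMul` instances (TorusMeasurableMul).
THE RESIDUAL (the (7b) census at this layer): `ht` · the two `CompactSpace` instances · the Haar normalisations
`νf νf' c c' hcμ hcμ' μinf μ₀ c₀ hc₀ hcμ₀` · the product `Z(k)`-domain data `νA νA' DA hDA hfd hDZc` · the product Haar split
`νS cq hcq` (Haar uniqueness on `T_f = T_S × T_f^{(p)}`: data) · the level prime `p hp hγ₀` · the sign data `hw hcm hα hβ hdef` ·
the K-type matching `hchi hchi'` (the display's own) · (S-FIN-NV)'s display `haway`.  NO (F) piece remains.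

Nothing here says anything about the status of the Hodge conjecture for CM abelian varieties, which is NOT proved
(HC_CM is NOT proved by anyone in this repository).
-/

set_option autoImplicit false

noncomputable section

namespace Summit.Ventures.HodgeRepro.Tier4.Line4

open Matrix MeasureTheory Topology Filter NumberField IsDedekindDomain Summit.Ventures.HodgeRepro.Tier4
  Summit.Ventures.HodgeRepro.Tier4.Common Summit.Ventures.HodgeRepro.Tier4.Line1
  Summit.Ventures.HodgeRepro.Tier4.Line1.RTF Summit.Ventures.HodgeRepro.Tier4.Line4.L1Class

open scoped NumberField NNReal ENNReal Pointwise Matrix ComplexConjugate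

section Generic

variable {k : Type} [Field k] [NumberField k] (W : PlaneData k) [MeasurableSpace (GA W)] [BorelSpace (GA W)]
  (R : RTFData W) (μ : Measure (GA W)) [μ.IsHaarMeasure] [R.μT.IsHaarMeasure] [R.μT'.IsHaarMeasure]
  (DG : Set (GA W)) (fdG : IsFundamentalDomain (rationalPoints W) DG μ) (compG : IsCompact (closure DG))
  (compT : IsCompact (closure R.DT)) (compT' : IsCompact (closure R.DT'))

/-- **C-L4-7B-GENERIC with (S-RATIO) by name**: the existential package of `TailForArch'''` from RatioBridge's data, the
level shift `n₁ ≥ max (n₁' of (S-SEP)) (c₀ + 1 of RatioBridge)` chosen inside. -/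
theorem exists_levelFamily_fibreDominated_of_ratio [MeasurableMul (torusT W)] [MeasurableMul (torusT' W)]
    (hRH : R.IsHaar)
    (hc : Continuous R.chi) (hu : ∀ a, ‖R.chi a‖ = 1) (hc' : Continuous R.chi') (hu' : ∀ a, ‖R.chi' a‖ = 1)
    (q : QuadData k) (g g' : Matrix (Fin 4) (Fin 4) k) (w₀ : InfinitePlace k) (eP eM eP' eM' : InfinitePlace k → ℤ)
    (hdet : W.B.det ≠ 0) (hgen : IsGenuineRow W)
    {d : k} (hΩ : W.Ω * W.Ω = -(d • (1 : Matrix (Fin 4) (Fin 4) k))) (hd : ¬ IsSquare (-d))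
    (hΩB : W.Ω * W.B = -(W.B * W.Ωᵀ)) (hPB : ∀ i, W.P i * W.B = W.B * (W.P i)ᵀ)
    (hQB : ∀ j, W.Q j * W.B = W.B * (W.Q j)ᵀ) (hPr : ∀ i, (W.P i).rank = 2) (hQr : ∀ j, (W.Q j).rank = 2)
    (γ₀ : rationalPoints W) (hreg : IsRegularRational W γ₀) (hlin : IsLinRegular W γ₀)
    (νinf : Measure (torusInf W)) [νinf.IsHaarMeasure] [IsFiniteMeasure νinf]
    (νf : Measure (torusFin W)) [νf.IsHaarMeasure]
    (c : ℝ≥0) (hc0 : 0 < c) (hcμ : R.μT = c • Measure.map (torusSplit W).symm (νinf.prod νf))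
    (νinf' : Measure (torusInf' W)) [νinf'.IsHaarMeasure] [IsFiniteMeasure νinf']
    (νf' : Measure (torusFin' W)) [νf'.IsHaarMeasure]
    (c' : ℝ≥0) (hc0' : 0 < c') (hcμ' : R.μT' = c' • Measure.map (torusSplit' W).symm (νinf'.prod νf'))
    (DZf : Set (torusFin W)) (hDZf : MeasurableSet DZf) (hfd : IsFundamentalDomain (centreFin W) DZf νf)
    (hDZc : ∀ C : Set (torusFin W), IsCompact C → IsCompact (closure (DZf ∩ (C * (ZfIn W : Set (torusFin W))))))
    (μinf : Measure (infinitePart W)) [μinf.IsHaarMeasure] (μ₀ : Measure (finitePart W)) [μ₀.IsHaarMeasure]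
    (c₀ : ℝ≥0) (hc₀ : 0 < c₀) (hcμ₀ : μ = c₀ • Measure.map (gaSplit W).symm (μinf.prod μ₀))
    (finf : GA W → ℂ)
    (hfinf : IsArchCoeffD W (Setting.ofAdelicData W R μ DG fdG compG compT compT') R q g g' w₀ eP eM eP' eM'
      (γ₀ : GA W) νinf νinf' finf)
    {e : GA W → ℂ} (he : IsInfFactor W e)
    (hequiv : ∀ (w : InfinitePlace k) (κ : GA W), κ ∈ localTorusAt' W w → ∀ x,
      e (x * κ) = weightAt' W q w g g' 0 κ ^ (-eP' w) * weightAt' W q w g g' 1 κ ^ (-eM' w) * e x)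
    (harch : L1Class.archFactor W R (convInf W μinf finf e) (γ₀ : GA W) νinf νinf' ≠ 0)
    (p : ℕ) (hp : p.Prime)
    (hγ₀ : ∀ v : HeightOneSpectrum (𝓞 k), natSize k v p < 1 → ∀ i j : Fin 4,
      Valued.v (finPart k (GA.mat W (γ₀ : GA W) i j) v) ≤ 1 ∧ Valued.v (finPart k (GA.mat W (γ₀ : GA W)⁻¹ i j) v) ≤ 1)
    -- (S-RATIO) by name (L1-p4's RatioBridge): the product Haar split of `νf` at `placesAbove p` and the CM input
    (νS : Measure (torusFinAt W (placesAbove (k := k) p))) [νS.IsHaarMeasure]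
    (νA : Measure (torusFinAway W (placesAbove (k := k) p))) [νA.IsHaarMeasure]
    (cq : ℝ≥0) (hcq : νf = cq • Measure.map (torusFinSplit W (placesAbove (k := k) p)).symm (νS.prod νA))
    (hZ : CentreFinFinite W)
    -- (S-UNIT) positivity, (S-COUNT), (S-SPARSE), (S-FIN-NV), `ChainInputs` — level-indexed
    (hv : ∀ M : ℕ, 0 < (suppMeasure W νf νf' (γ₀ : GA W) DZf (p ^ M) (γ₀ : GA W)).toReal)
    (hcount : SublevelCount₀ W (Setting.ofAdelicData W R μ DG fdG compG compT compT'))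
    (gth : ℕ → ℝ) (hg : Tendsto gth atTop atTop)
    (hR : ∀ (M : ℕ) (γ : (Setting.ofAdelicData W R μ DG fdG compG compT compT').Gk),
      (Setting.ofAdelicData W R μ DG fdG compG compT compT').orbitOf γ ∉
        ({(Setting.ofAdelicData W R μ DG fdG compG compT compT').orbitOf γ₀} :
          Finset (Setting.ofAdelicData W R μ DG fdG compG compT compT').Orbit) →
      (∃ t ∈ R.DT, ∃ t' ∈ R.DT',
        (Setting.ofAdelicData W R μ DG fdG compG compT compT').conv
          (prodFn W finf (ffinMu W μ₀ (γ₀ : GA W) (p ^ M))) (testNat W e (p ^ M))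
          ((t : GA W)⁻¹ * γ * (t' : GA W)) ≠ 0) →
      gth (p ^ M) ≤ archDist W (γ : GA W))
    (hnv : ∃ δ : ℝ, 0 < δ ∧ ∃ M₀ : ℕ, ∀ M ≥ M₀,
      δ * (suppMeasure W νf νf' (γ₀ : GA W) DZf (p ^ M) (γ₀ : GA W)).toReal ≤
        ‖∫ b in DZf, R.chi b * innerFin W R (levelDC W (γ₀ : GA W) (p ^ M)) (γ₀ : GA W) νf' b ∂νf‖)
    (hchain : ∀ M : ℕ, ChainInputs W R γ₀ νinf νf νinf' νf' DZf
      ((Setting.ofAdelicData W R μ DG fdG compG compT compT').conv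
        (prodFn W finf (ffinMu W μ₀ (γ₀ : GA W) (p ^ M))) (testNat W e (p ^ M)))
      (fun x => (c₀ : ℂ) * convInf W μinf finf e x) (levelDC W (γ₀ : GA W) (p ^ M))) :
    ∃ lev : ℕ → ℕ, (∀ n, lev n ≠ 0) ∧
    ∃ ffin f₂ : ℕ → GA W → ℂ, TailFamily' W q g g' eP' eM' (γ₀ : GA W) ffin f₂ ∧
      ∃ E : Finset (Setting.ofAdelicData W R μ DG fdG compG compT compT').Orbit,
        (Setting.ofAdelicData W R μ DG fdG compG compT compT').orbitOf γ₀ ∈ E ∧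
        FibreDominatedFrom (Setting.ofAdelicData W R μ DG fdG compG compT compT') R.chi R.chi' E
          (fun n => (Setting.ofAdelicData W R μ DG fdG compG compT compT').conv
            (prodFn W finf (ffin (lev n))) (f₂ (lev n))) := by
  -- (S-RATIO) by name: the threshold `c₀` of RatioBridge
  obtain ⟨c₀r, hbr⟩ := exists_hratio_of_ratioFinal W R hΩ hd hΩB hPB hQB hPr hQr hdet hgen γ₀ hlin p hp hγ₀ hRH compT
    compT' νinf νf c hcμ νinf' νf' c' hcμ' νS νA cq hcq DZf hDZf hfd hDZc hZ
  -- (S-SEP) by name: the separation threshold; the level shift `n₁` is the larger of the two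
  obtain ⟨n₁', hsep'⟩ := exists_level_separates_transporter W hgen γ₀ hlin p hp
  obtain ⟨n₁, hn₁s, hn₁r⟩ : ∃ n₁ : ℕ, n₁' ≤ n₁ ∧ c₀r + 1 ≤ n₁ := ⟨max n₁' (c₀r + 1), le_max_left _ _, le_max_right _ _⟩
  obtain ⟨C', hC', hratio⟩ := hbr n₁ hn₁r
  have hsep : ∀ n ≥ n₁, ∀ γ : rationalPoints W,
      (torusT W).map (MulAut.conj ((γ : GA W))⁻¹).toMonoidHom = torusT' W →
      ∀ t ∈ torusT W, ∀ t' ∈ torusT' W,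
        GA.ofFinPart W (t⁻¹ * (γ : GA W) * t') ∉ levelDoubleCoset W (p ^ n) (GA.ofFinPart W (γ₀ : GA W)) :=
    fun n hn => hsep' n (le_trans hn₁s hn)
  have hpN : ∀ N : ℕ, p ^ (N + n₁) ≠ 0 := fun N => pow_ne_zero _ hp.ne_zero
  -- the family at level `p ^ (N + n₁)` in the two spellings
  have hff : ∀ N : ℕ, ffinMuNat W μ₀ (γ₀ : GA W) (fun n => p ^ (n + n₁)) (p ^ (N + n₁)) =
      ffinMu W μ₀ (γ₀ : GA W) (p ^ (N + n₁)) := fun N =>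
    ffinMuNat_lev W μ₀ (γ₀ : GA W) (lev := fun n => p ^ (n + n₁)) (n := N) (hpN N)
  -- the scale along the level sequence
  have hg' : Tendsto (fun N : ℕ => gth (p ^ (N + n₁))) atTop atTop :=
    hg.comp ((tendsto_pow_atTop_atTop_of_one_lt hp.one_lt).comp (tendsto_add_atTop_nat n₁))
  -- (S-SPARSE) at the `ffinMuNat` spelling
  have hR' : ∀ (N : ℕ) (γ : (Setting.ofAdelicData W R μ DG fdG compG compT compT').Gk),
      (Setting.ofAdelicData W R μ DG fdG compG compT compT').orbitOf γ ∉
        ({(Setting.ofAdelicData W R μ DG fdG compG compT compT').orbitOf γ₀} :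
          Finset (Setting.ofAdelicData W R μ DG fdG compG compT compT').Orbit) →
      (∃ t ∈ R.DT, ∃ t' ∈ R.DT',
        (Setting.ofAdelicData W R μ DG fdG compG compT compT').conv
          (prodFn W finf (ffinMuNat W μ₀ (γ₀ : GA W) (fun n => p ^ (n + n₁)) (p ^ (N + n₁))))
          (testNat W e (p ^ (N + n₁))) ((t : GA W)⁻¹ * γ * (t' : GA W)) ≠ 0) →
      gth (p ^ (N + n₁)) ≤ archDist W (γ : GA W) := by
    intro N γ h1 h2
    rw [hff N] at h2
    exact hR (N + n₁) γ h1 h2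
  -- (S-FIN-NV) re-indexed
  have hnv' : ∃ δ : ℝ, 0 < δ ∧ ∃ N₀ : ℕ, ∀ N ≥ N₀,
      δ * (suppMeasure W νf νf' (γ₀ : GA W) DZf (p ^ (N + n₁)) (γ₀ : GA W)).toReal ≤
        ‖∫ b in DZf, R.chi b * innerFin W R (levelDC W (γ₀ : GA W) (p ^ (N + n₁))) (γ₀ : GA W) νf' b ∂νf‖ := by
    obtain ⟨δ, hδ, M₀, h⟩ := hnv
    exact ⟨δ, hδ, M₀, fun N hN => h (N + n₁) (le_trans hN (Nat.le_add_right N n₁))⟩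
  -- `ChainInputs` at the `ffinMuNat` spelling
  have hchain' : ∀ N : ℕ, ChainInputs W R γ₀ νinf νf νinf' νf' DZf
      ((Setting.ofAdelicData W R μ DG fdG compG compT compT').conv
        (prodFn W finf (ffinMuNat W μ₀ (γ₀ : GA W) (fun n => p ^ (n + n₁)) (p ^ (N + n₁))))
        (testNat W e (p ^ (N + n₁))))
      (fun x => (c₀ : ℂ) * convInf W μinf finf e x) (levelDC W (γ₀ : GA W) (p ^ (N + n₁))) := by
    intro N
    rw [hff N]
    exact hchain (N + n₁)
  exact exists_levelFamily_fibreDominated_of_displays_main W R μ DG fdG compG compT compT' hRH hc hu hc' hu' q g g' w₀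
    eP eM eP' eM' γ₀ hreg νinf νf c hc0 hcμ νinf' νf' c' hc0' hcμ' DZf hDZf hfd μinf μ₀ c₀ hc₀ hcμ₀ finf hfinf he hequiv
    harch p n₁ hp hγ₀ hsep C' hC' hratio (fun N => hv (N + n₁)) hcount (fun N => gth (p ^ (N + n₁))) hg' hR' hnv' hchain'

end Generic

section Ratio

variable {k : Type} [Field k] [NumberField k]

/-- **The (7b) display body at the plane of record with (S-RATIO), (S-COUNT), `ChainInputs`, `hdet`, `D` and the
`MeasurableMul` instances by name.** -/
theorem tailForArch_seesaw_of_ratio (q : QuadData k) (ht : q.t = 0) (hn : ¬ IsSquare (-q.n))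
    (a : Fin 4 → k) (ha : ∀ i, a i ≠ 0)
    (g g' : Matrix (Fin 4) (Fin 4) k) (hgg' : g * g' = 1) (hg'g : g' * g = 1)
    (hgΩ : g * (PlaneData.mixedRow q (a 0) (a 2)).Ω = (PlaneData.mixedRow q (a 0) (a 2)).Ω * g)
    (lam : k) (hlam : lam ≠ 0)
    (hiso : g * (PlaneData.mixedRow q (a 1) (a 3)).B * gᵀ = lam • (PlaneData.mixedRow q (a 0) (a 2)).B)
    [MeasurableSpace (GA ((PlaneData.mixedRow q (a 0) (a 2)).withTransportedTorus g g' hgg' hg'g hgΩ))] [BorelSpace (GA ((PlaneData.mixedRow q (a 0) (a 2)).withTransportedTorus g g' hgg' hg'g hgΩ))]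
    (R : RTFData ((PlaneData.mixedRow q (a 0) (a 2)).withTransportedTorus g g' hgg' hg'g hgΩ)) (hRH : R.IsHaar)
    (hc : Continuous R.chi) (hu : ∀ a, ‖R.chi a‖ = 1) (hc' : Continuous R.chi') (hu' : ∀ a, ‖R.chi' a‖ = 1)
    (w₀ : InfinitePlace k) (eP eM eP' eM' : InfinitePlace k → ℤ)
    -- the K-type matching of the display (its own `_hchi` / `_hchi'`), in `D : KTypeData`'s place
    (hchi : ∀ w, ChiMatchesAt ((PlaneData.mixedRow q (a 0) (a 2)).withTransportedTorus g g' hgg' hg'g hgΩ) q w (eP w) (eM w) R.chi)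
    (hchi' : ∀ w, ChiMatchesAt' ((PlaneData.mixedRow q (a 0) (a 2)).withTransportedTorus g g' hgg' hg'g hgΩ) q w g g' (eP' w) (eM' w) R.chi')
    [R.μT.IsHaarMeasure] [R.μT'.IsHaarMeasure]
    (μ : Measure (GA ((PlaneData.mixedRow q (a 0) (a 2)).withTransportedTorus g g' hgg' hg'g hgΩ))) [μ.IsHaarMeasure] (DG : Set (GA ((PlaneData.mixedRow q (a 0) (a 2)).withTransportedTorus g g' hgg' hg'g hgΩ))) (fdG : IsFundamentalDomain (rationalPoints ((PlaneData.mixedRow q (a 0) (a 2)).withTransportedTorus g g' hgg' hg'g hgΩ)) DG μ)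
    (compG : IsCompact (closure DG)) (compT : IsCompact (closure R.DT)) (compT' : IsCompact (closure R.DT'))
    (γ₀ : rationalPoints ((PlaneData.mixedRow q (a 0) (a 2)).withTransportedTorus g g' hgg' hg'g hgΩ)) (hlin : IsLinRegular ((PlaneData.mixedRow q (a 0) (a 2)).withTransportedTorus g g' hgg' hg'g hgΩ) γ₀)
    (νinf : Measure (torusInf ((PlaneData.mixedRow q (a 0) (a 2)).withTransportedTorus g g' hgg' hg'g hgΩ))) [νinf.IsHaarMeasure] [CompactSpace (torusInf ((PlaneData.mixedRow q (a 0) (a 2)).withTransportedTorus g g' hgg' hg'g hgΩ))]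
    (νf : Measure (torusFin ((PlaneData.mixedRow q (a 0) (a 2)).withTransportedTorus g g' hgg' hg'g hgΩ))) [νf.IsHaarMeasure]
    (c : ℝ≥0) (hc0 : 0 < c) (hcμ : R.μT = c • Measure.map (torusSplit ((PlaneData.mixedRow q (a 0) (a 2)).withTransportedTorus g g' hgg' hg'g hgΩ)).symm (νinf.prod νf))
    (νinf' : Measure (torusInf' ((PlaneData.mixedRow q (a 0) (a 2)).withTransportedTorus g g' hgg' hg'g hgΩ))) [νinf'.IsHaarMeasure] [CompactSpace (torusInf' ((PlaneData.mixedRow q (a 0) (a 2)).withTransportedTorus g g' hgg' hg'g hgΩ))]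
    (νf' : Measure (torusFin' ((PlaneData.mixedRow q (a 0) (a 2)).withTransportedTorus g g' hgg' hg'g hgΩ))) [νf'.IsHaarMeasure]
    (c' : ℝ≥0) (hc0' : 0 < c') (hcμ' : R.μT' = c' • Measure.map (torusSplit' ((PlaneData.mixedRow q (a 0) (a 2)).withTransportedTorus g g' hgg' hg'g hgΩ)).symm (νinf'.prod νf'))
    (p : ℕ) (hp : p.Prime)
    (hγ₀ : ∀ v : HeightOneSpectrum (𝓞 k), natSize k v p < 1 → ∀ i j : Fin 4,
      Valued.v (finPart k (GA.mat ((PlaneData.mixedRow q (a 0) (a 2)).withTransportedTorus g g' hgg' hg'g hgΩ) (γ₀ : GA ((PlaneData.mixedRow q (a 0) (a 2)).withTransportedTorus g g' hgg' hg'g hgΩ)) i j) v) ≤ 1 ∧ Valued.v (finPart k (GA.mat ((PlaneData.mixedRow q (a 0) (a 2)).withTransportedTorus g g' hgg' hg'g hgΩ) (γ₀ : GA ((PlaneData.mixedRow q (a 0) (a 2)).withTransportedTorus g g' hgg' hg'g hgΩ))⁻¹ i j) v) ≤ 1)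
    -- the product `Z(k)`-domain of record `torusFinSplit⁻¹(univ ×ˢ DA)` (AwayDomain) and its fundamental-domain /
    -- compactness data (ZDOMAIN-EX (iv) at the product domain); the away measures and (S-FIN-NV)'s display `haway`
    (νA : Measure (torusFinAway ((PlaneData.mixedRow q (a 0) (a 2)).withTransportedTorus g g' hgg' hg'g hgΩ) (placesAbove (k := k) p))) [νA.IsHaarMeasure]
    (νA' : Measure (torusFinAway' ((PlaneData.mixedRow q (a 0) (a 2)).withTransportedTorus g g' hgg' hg'g hgΩ) (placesAbove (k := k) p))) [νA'.IsHaarMeasure]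
    (DA : Set (torusFinAway ((PlaneData.mixedRow q (a 0) (a 2)).withTransportedTorus g g' hgg' hg'g hgΩ) (placesAbove (k := k) p))) (hDA : MeasurableSet DA)
    (hfd : IsFundamentalDomain (centreFin ((PlaneData.mixedRow q (a 0) (a 2)).withTransportedTorus g g' hgg' hg'g hgΩ)) ((torusFinSplit ((PlaneData.mixedRow q (a 0) (a 2)).withTransportedTorus g g' hgg' hg'g hgΩ) (placesAbove (k := k) p)) ⁻¹' (Set.univ ×ˢ DA)) νf)
    (hDZc : ∀ C : Set (torusFin ((PlaneData.mixedRow q (a 0) (a 2)).withTransportedTorus g g' hgg' hg'g hgΩ)), IsCompact C → IsCompact (closure (((torusFinSplit ((PlaneData.mixedRow q (a 0) (a 2)).withTransportedTorus g g' hgg' hg'g hgΩ) (placesAbove (k := k) p)) ⁻¹' (Set.univ ×ˢ DA)) ∩ (C * (ZfIn ((PlaneData.mixedRow q (a 0) (a 2)).withTransportedTorus g g' hgg' hg'g hgΩ) : Set (torusFin ((PlaneData.mixedRow q (a 0) (a 2)).withTransportedTorus g g' hgg' hg'g hgΩ)))))))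
    (haway : awayOrbital ((PlaneData.mixedRow q (a 0) (a 2)).withTransportedTorus g g' hgg' hg'g hgΩ) (placesAbove (k := k) p) R (γ₀ : GA ((PlaneData.mixedRow q (a 0) (a 2)).withTransportedTorus g g' hgg' hg'g hgΩ)) νA νA' DA ≠ 0)
    (μinf : Measure (infinitePart ((PlaneData.mixedRow q (a 0) (a 2)).withTransportedTorus g g' hgg' hg'g hgΩ))) [μinf.IsHaarMeasure] (μ₀ : Measure (finitePart ((PlaneData.mixedRow q (a 0) (a 2)).withTransportedTorus g g' hgg' hg'g hgΩ))) [μ₀.IsHaarMeasure]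
    (c₀ : ℝ≥0) (hc₀ : 0 < c₀) (hcμ₀ : μ = c₀ • Measure.map (gaSplit ((PlaneData.mixedRow q (a 0) (a 2)).withTransportedTorus g g' hgg' hg'g hgΩ)).symm (μinf.prod μ₀))
    -- (S-RATIO) by name (L1-p4's RatioBridge): the product Haar split of `νf` at `placesAbove p` (`νA` is the away
    -- measure bound above, the one of `haway`)
    (νS : Measure (torusFinAt ((PlaneData.mixedRow q (a 0) (a 2)).withTransportedTorus g g' hgg' hg'g hgΩ) (placesAbove (k := k) p))) [νS.IsHaarMeasure] (cq : ℝ≥0)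
    (hcq : νf = cq • Measure.map (torusFinSplit ((PlaneData.mixedRow q (a 0) (a 2)).withTransportedTorus g g' hgg' hg'g hgΩ) (placesAbove (k := k) p)).symm (νS.prod νA))
    -- (S-COUNT) BY NAME: the sign data of display (8) in `hcount`'s place — `w₀` (already bound: the indefinite place of
    -- `IsArchCoeffD`) real and CM, the `(1,1)` signs `hα hβ` at `w₀`, and the ONE displayed definiteness clause `hdef`
    (hw : w₀.IsReal) (hcm : IsCMAt q w₀) (hα : 0 < alphaLoc (a 0) hw) (hβ : betaLoc (a 2) (-1) hw < 0)
    (hdef : SeesawDefinite q a w₀) :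
    ∀ finf : GA ((PlaneData.mixedRow q (a 0) (a 2)).withTransportedTorus g g' hgg' hg'g hgΩ) → ℂ,
      IsArchCoeffD ((PlaneData.mixedRow q (a 0) (a 2)).withTransportedTorus g g' hgg' hg'g hgΩ) (Setting.ofAdelicData ((PlaneData.mixedRow q (a 0) (a 2)).withTransportedTorus g g' hgg' hg'g hgΩ) R μ DG fdG compG compT compT') R q g g' w₀ eP eM eP' eM'
        (γ₀ : GA ((PlaneData.mixedRow q (a 0) (a 2)).withTransportedTorus g g' hgg' hg'g hgΩ)) νinf νinf' finf →
      ∃ lev : ℕ → ℕ, (∀ n, lev n ≠ 0) ∧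
      ∃ ffin f₂ : ℕ → GA ((PlaneData.mixedRow q (a 0) (a 2)).withTransportedTorus g g' hgg' hg'g hgΩ) → ℂ, TailFamily' ((PlaneData.mixedRow q (a 0) (a 2)).withTransportedTorus g g' hgg' hg'g hgΩ) q g g' eP' eM' (γ₀ : GA ((PlaneData.mixedRow q (a 0) (a 2)).withTransportedTorus g g' hgg' hg'g hgΩ)) ffin f₂ ∧
        ∃ E : Finset (Setting.ofAdelicData ((PlaneData.mixedRow q (a 0) (a 2)).withTransportedTorus g g' hgg' hg'g hgΩ) R μ DG fdG compG compT compT').Orbit,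
          (Setting.ofAdelicData ((PlaneData.mixedRow q (a 0) (a 2)).withTransportedTorus g g' hgg' hg'g hgΩ) R μ DG fdG compG compT compT').orbitOf γ₀ ∈ E ∧
          FibreDominatedFrom (Setting.ofAdelicData ((PlaneData.mixedRow q (a 0) (a 2)).withTransportedTorus g g' hgg' hg'g hgΩ) R μ DG fdG compG compT compT') R.chi R.chi' E
            (fun n => (Setting.ofAdelicData ((PlaneData.mixedRow q (a 0) (a 2)).withTransportedTorus g g' hgg' hg'g hgΩ) R μ DG fdG compG compT compT').conv
              (prodFn ((PlaneData.mixedRow q (a 0) (a 2)).withTransportedTorus g g' hgg' hg'g hgΩ) finf (ffin (lev n))) (f₂ (lev n))) := by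
  -- display (8)'s archimedean print from the sign data (ArchBallMixed), `VolumeGrowth` (ArchBallReduce), the packing
  -- count `SublevelCount₀` (SublevelOfVolume) and the Poincaré clause `PoincareOfDecay` (SublevelCountGlue)
  have hq4 : 4 * q.n - q.t ^ 2 ≠ 0 := disc_ne_zero_of_isCMAt q w₀ hw hcm
  -- the non-degeneracy `hdet` of the plane's trace form by name (typer-2's RowPlane: `det = a₀² a₂² (4n − t²)²`)
  have hdet : (((PlaneData.mixedRow q (a 0) (a 2)).withTransportedTorus g g' hgg' hg'g hgΩ)).B.det ≠ 0 :=
    (mixedRow_withTransportedTorus_isHermitianRow q (a 0) (a 2) (ha 0) (ha 2)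
      (fun h => hq4 (by linear_combination -h)) g g' hgg' hg'g hgΩ).1.2.2.2.2
  -- the two `MeasurableMul` instances by name (L4-p1's TorusMeasurableMul)
  haveI : MeasurableMul (torusT ((PlaneData.mixedRow q (a 0) (a 2)).withTransportedTorus g g' hgg' hg'g hgΩ)) := measurableMul_torusT _
  haveI : MeasurableMul (torusT' ((PlaneData.mixedRow q (a 0) (a 2)).withTransportedTorus g g' hgg' hg'g hgΩ)) := measurableMul_torusT' _
  -- every infinite place of `k` is real and CM (`hw`, `hcm` at `w₀`; `hdef` elsewhere)
  have hreal : ∀ w : InfinitePlace k, w.IsReal := fun w => by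
    by_cases h : w = w₀
    · exact h ▸ hw
    · exact (hdef w h).1
  have hcmAll : ∀ w : InfinitePlace k, IsCMAt q w := fun w => by
    by_cases h : w = w₀
    · exact h ▸ hcm
    · exact (hdef w h).2.1
  -- the K-type data of the archimedean test by name (L4-p1's KTypeDataSeesaw)
  have D : KTypeData ((PlaneData.mixedRow q (a 0) (a 2)).withTransportedTorus g g' hgg' hg'g hgΩ) R q g g' eP eM eP' eM' :=
    kTypeData_seesaw q a g g' hgg' hg'g hgΩ R ha lam hlam hiso hreal hcmAll eP eM eP' eM' hchi hchi'
  have hball : ArchBallGrowth ((PlaneData.mixedRow q (a 0) (a 2)).withTransportedTorus g g' hgg' hg'g hgΩ) μinf :=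
    archBallGrowth_mixedRow_withTransportedTorus q (a 0) (a 2) g g' hgg' hg'g hgΩ hw hcm hq4 hα hβ
      (hdef_of_seesawDefinite hdef) μinf
  haveI : (Setting.ofAdelicData ((PlaneData.mixedRow q (a 0) (a 2)).withTransportedTorus g g' hgg' hg'g hgΩ) R μ DG fdG compG compT compT').μ.IsHaarMeasure :=
    inferInstanceAs (μ.IsHaarMeasure)
  have hcount : SublevelCount₀ ((PlaneData.mixedRow q (a 0) (a 2)).withTransportedTorus g g' hgg' hg'g hgΩ) (Setting.ofAdelicData ((PlaneData.mixedRow q (a 0) (a 2)).withTransportedTorus g g' hgg' hg'g hgΩ) R μ DG fdG compG compT compT') :=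
    sublevelCount₀_of_volumeGrowth _ _
      (volumeGrowth_of_archBallGrowth' _ (Setting.ofAdelicData ((PlaneData.mixedRow q (a 0) (a 2)).withTransportedTorus g g' hgg' hg'g hgΩ) R μ DG fdG compG compT compT') μinf μ₀ hball)
  have h8 : PoincareOfDecay ((PlaneData.mixedRow q (a 0) (a 2)).withTransportedTorus g g' hgg' hg'g hgΩ) (Setting.ofAdelicData ((PlaneData.mixedRow q (a 0) (a 2)).withTransportedTorus g g' hgg' hg'g hgΩ) R μ DG fdG compG compT compT') :=
    poincareOfDecay_of_sublevelCount _ _ (sublevelCount_of_sublevelCount₀ _ _ hcount)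
  -- the data shared by every `ChainInputs` instance: the genuine row, PROPER at `γ₀`, the measurable product domain
  have hgen : IsGenuineRow ((PlaneData.mixedRow q (a 0) (a 2)).withTransportedTorus g g' hgg' hg'g hgΩ) := isGenuineRow_seesawPlane q ht hn a (ha 0) (ha 2) g g' hgg' hg'g hgΩ lam hlam hiso
  have hprop : HasProperFinOrbit ((PlaneData.mixedRow q (a 0) (a 2)).withTransportedTorus g g' hgg' hg'g hgΩ) (γ₀ : GA ((PlaneData.mixedRow q (a 0) (a 2)).withTransportedTorus g g' hgg' hg'g hgΩ)) := hasProperFinOrbit_of_isLinRegular ((PlaneData.mixedRow q (a 0) (a 2)).withTransportedTorus g g' hgg' hg'g hgΩ) hdet hgen γ₀ hlin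
  have hDZf : MeasurableSet ((torusFinSplit ((PlaneData.mixedRow q (a 0) (a 2)).withTransportedTorus g g' hgg' hg'g hgΩ) (placesAbove (k := k) p)) ⁻¹' (Set.univ ×ˢ DA)) :=
    measurableSet_preimage_torusFinSplit_prod ((PlaneData.mixedRow q (a 0) (a 2)).withTransportedTorus g g' hgg' hg'g hgΩ) (placesAbove (k := k) p) MeasurableSet.univ hDA
  -- `ChainInputs` at the witness, for every admissible `(finf, e)` and every level `p ^ M` (`chainInputs_witness_of_pieces`
  -- at `n₁ := 0`, `N := M`)
  have hchain : ∀ finf : GA ((PlaneData.mixedRow q (a 0) (a 2)).withTransportedTorus g g' hgg' hg'g hgΩ) → ℂ,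
      IsArchCoeffD ((PlaneData.mixedRow q (a 0) (a 2)).withTransportedTorus g g' hgg' hg'g hgΩ) (Setting.ofAdelicData ((PlaneData.mixedRow q (a 0) (a 2)).withTransportedTorus g g' hgg' hg'g hgΩ) R μ DG fdG compG compT compT') R q g g' w₀ eP eM eP' eM'
        (γ₀ : GA ((PlaneData.mixedRow q (a 0) (a 2)).withTransportedTorus g g' hgg' hg'g hgΩ)) νinf νinf' finf →
      ∀ e : GA ((PlaneData.mixedRow q (a 0) (a 2)).withTransportedTorus g g' hgg' hg'g hgΩ) → ℂ, IsInfFactor ((PlaneData.mixedRow q (a 0) (a 2)).withTransportedTorus g g' hgg' hg'g hgΩ) e →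
        (∀ (w : InfinitePlace k) (κ : GA ((PlaneData.mixedRow q (a 0) (a 2)).withTransportedTorus g g' hgg' hg'g hgΩ)), κ ∈ localTorusAt' ((PlaneData.mixedRow q (a 0) (a 2)).withTransportedTorus g g' hgg' hg'g hgΩ) w → ∀ x,
          e (x * κ) = weightAt' ((PlaneData.mixedRow q (a 0) (a 2)).withTransportedTorus g g' hgg' hg'g hgΩ) q w g g' 0 κ ^ (-eP' w) * weightAt' ((PlaneData.mixedRow q (a 0) (a 2)).withTransportedTorus g g' hgg' hg'g hgΩ) q w g g' 1 κ ^ (-eM' w) * e x) →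
        L1Class.archFactor ((PlaneData.mixedRow q (a 0) (a 2)).withTransportedTorus g g' hgg' hg'g hgΩ) R (convInf ((PlaneData.mixedRow q (a 0) (a 2)).withTransportedTorus g g' hgg' hg'g hgΩ) μinf finf e) (γ₀ : GA ((PlaneData.mixedRow q (a 0) (a 2)).withTransportedTorus g g' hgg' hg'g hgΩ)) νinf νinf' ≠ 0 →
        ∀ M : ℕ, ChainInputs ((PlaneData.mixedRow q (a 0) (a 2)).withTransportedTorus g g' hgg' hg'g hgΩ) R γ₀ νinf νf νinf' νf' ((torusFinSplit ((PlaneData.mixedRow q (a 0) (a 2)).withTransportedTorus g g' hgg' hg'g hgΩ) (placesAbove (k := k) p)) ⁻¹' (Set.univ ×ˢ DA))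
          ((Setting.ofAdelicData ((PlaneData.mixedRow q (a 0) (a 2)).withTransportedTorus g g' hgg' hg'g hgΩ) R μ DG fdG compG compT compT').conv
            (prodFn ((PlaneData.mixedRow q (a 0) (a 2)).withTransportedTorus g g' hgg' hg'g hgΩ) finf (ffinMu ((PlaneData.mixedRow q (a 0) (a 2)).withTransportedTorus g g' hgg' hg'g hgΩ) μ₀ (γ₀ : GA ((PlaneData.mixedRow q (a 0) (a 2)).withTransportedTorus g g' hgg' hg'g hgΩ)) (p ^ M))) (testNat ((PlaneData.mixedRow q (a 0) (a 2)).withTransportedTorus g g' hgg' hg'g hgΩ) e (p ^ M)))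
          (fun x => (c₀ : ℂ) * convInf ((PlaneData.mixedRow q (a 0) (a 2)).withTransportedTorus g g' hgg' hg'g hgΩ) μinf finf e x) (levelDC ((PlaneData.mixedRow q (a 0) (a 2)).withTransportedTorus g g' hgg' hg'g hgΩ) (γ₀ : GA ((PlaneData.mixedRow q (a 0) (a 2)).withTransportedTorus g g' hgg' hg'g hgΩ)) (p ^ M)) := by
    intro finf hfinf e he _ _ M
    have hN : p ^ M ≠ 0 := pow_ne_zero _ hp.ne_zero
    -- the archimedean factor `c₀ · (finf ∗ e)`: continuous, of weight-3 decay, bounded (ConvInfRegularity)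
    have hFinfc : Continuous (fun x => (c₀ : ℂ) * convInf ((PlaneData.mixedRow q (a 0) (a 2)).withTransportedTorus g g' hgg' hg'g hgΩ) μinf finf e x) :=
      continuous_const_mul_convInf _ μinf hfinf.cont he (c₀ : ℂ)
    have hdec : HasDecay3 ((PlaneData.mixedRow q (a 0) (a 2)).withTransportedTorus g g' hgg' hg'g hgΩ) (fun x => (c₀ : ℂ) * convInf ((PlaneData.mixedRow q (a 0) (a 2)).withTransportedTorus g g' hgg' hg'g hgΩ) μinf finf e x) :=
      hasDecay3_const_mul_convInf _ μinf hfinf.decay he (c₀ : ℂ)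
    obtain ⟨C, hC⟩ := exists_norm_const_mul_convInf_le ((PlaneData.mixedRow q (a 0) (a 2)).withTransportedTorus g g' hgg' hg'g hgΩ) μinf hfinf.decay he (c₀ : ℂ)
    -- the FIN clauses `hB hIfin hint` at `levelDC (p ^ M)` (ChainInputsFin) and (B1) at the product form (ChainInputsFin2)
    obtain ⟨hB, hIfin, hint⟩ := chainInputs_fin_clauses_of_isLinRegular ((PlaneData.mixedRow q (a 0) (a 2)).withTransportedTorus g g' hgg' hg'g hgΩ) R hc hu hc' hu' hdet hgen γ₀ hlin νf νf' hN
      _ hDZf hDZc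
    have hprod := witness_isProductFn ((PlaneData.mixedRow q (a 0) (a 2)).withTransportedTorus g g' hgg' hg'g hgΩ) R μ DG fdG compG compT compT' (γ₀ : GA ((PlaneData.mixedRow q (a 0) (a 2)).withTransportedTorus g g' hgg' hg'g hgΩ)) μinf μ₀ c₀ hcμ₀ finf e p 0 M
      hp.ne_zero
    have hB1 := integrableOn_chi_mul_innerFull_prodDomain_of_isProductFn_levelDC ((PlaneData.mixedRow q (a 0) (a 2)).withTransportedTorus g g' hgg' hg'g hgΩ) R hRH hc hu hc' hu' γ₀ hN _ _
      hprod hFinfc hprop _ hDZf hDZc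
    -- the ARCH clauses `hA` / `hIinf` (ConvInfRegularity on IntegArch)
    have hA := fun t => integrable_conj_chi'_mul_const_mul_convInf ((PlaneData.mixedRow q (a 0) (a 2)).withTransportedTorus g g' hgg' hg'g hgΩ) R hc' hu' νinf' μinf hfinf.cont he (c₀ : ℂ)
      (γ₀ : GA ((PlaneData.mixedRow q (a 0) (a 2)).withTransportedTorus g g' hgg' hg'g hgΩ)) t
    have hIinf := integrable_chi_mul_innerInf_const_mul_convInf ((PlaneData.mixedRow q (a 0) (a 2)).withTransportedTorus g g' hgg' hg'g hgΩ) R hc hu hc' hu' νinf νinf' μinf hfinf.cont he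
      (c₀ : ℂ) (γ₀ : GA ((PlaneData.mixedRow q (a 0) (a 2)).withTransportedTorus g g' hgg' hg'g hgΩ))
    have key := chainInputs_witness_of_pieces ((PlaneData.mixedRow q (a 0) (a 2)).withTransportedTorus g g' hgg' hg'g hgΩ) R μ DG fdG compG compT compT' hRH hc hu hc' hu' γ₀ νinf νf νinf' νf' _
      μinf μ₀ c₀ hcμ₀ finf e p 0 M hp.ne_zero h8 hFinfc hdec C hC hB1 hA hB hIinf hIfin hint
    simp only [Nat.add_zero] at key
    rwa [ffinMuNat_lev ((PlaneData.mixedRow q (a 0) (a 2)).withTransportedTorus g g' hgg' hg'g hgΩ) μ₀ (γ₀ : GA ((PlaneData.mixedRow q (a 0) (a 2)).withTransportedTorus g g' hgg' hg'g hgΩ)) (lev := fun n => p ^ n) (n := M) hN] at key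
  -- the seesaw instance of the generic layer: the plane facts, the unit positivity `hv`, the archimedean test (ARCHAPPROX
  -- through `D`), (S-SPARSE) by name, (S-FIN-NV) by name, then `exists_levelFamily_fibreDominated_of_ratio`
  intro finf hfinf
  haveI : νinf'.IsMulRightInvariant := isMulRightInvariant_of_compactSpace νinf'
  haveI : IsFiniteMeasure νinf := CompactSpace.isFiniteMeasure
  haveI : IsFiniteMeasure νinf' := CompactSpace.isFiniteMeasure
  have hreg : IsRegularRational ((PlaneData.mixedRow q (a 0) (a 2)).withTransportedTorus g g' hgg' hg'g hgΩ) γ₀ := isRegularRational_of_isLinRegular _ γ₀ hlin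
  have hZ : CentreFinFinite ((PlaneData.mixedRow q (a 0) (a 2)).withTransportedTorus g g' hgg' hg'g hgΩ) := centreFinFinite_of_compactSpace_torusInf _
  have hpM : ∀ M : ℕ, p ^ M ≠ 0 := fun M => pow_ne_zero _ hp.ne_zero
  have hv : ∀ M : ℕ, 0 < (suppMeasure ((PlaneData.mixedRow q (a 0) (a 2)).withTransportedTorus g g' hgg' hg'g hgΩ) νf νf' (γ₀ : GA ((PlaneData.mixedRow q (a 0) (a 2)).withTransportedTorus g g' hgg' hg'g hgΩ)) ((torusFinSplit ((PlaneData.mixedRow q (a 0) (a 2)).withTransportedTorus g g' hgg' hg'g hgΩ) (placesAbove (k := k) p)) ⁻¹' (Set.univ ×ˢ DA)) (p ^ M) (γ₀ : GA ((PlaneData.mixedRow q (a 0) (a 2)).withTransportedTorus g g' hgg' hg'g hgΩ))).toReal := fun M =>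
    suppMeasure_toReal_pos_of_beta ((PlaneData.mixedRow q (a 0) (a 2)).withTransportedTorus g g' hgg' hg'g hgΩ) νf νf' (γ₀ : GA ((PlaneData.mixedRow q (a 0) (a 2)).withTransportedTorus g g' hgg' hg'g hgΩ)) ((torusFinSplit ((PlaneData.mixedRow q (a 0) (a 2)).withTransportedTorus g g' hgg' hg'g hgΩ) (placesAbove (k := k) p)) ⁻¹' (Set.univ ×ˢ DA)) hDZf hfd hZ (hpM M)
      (suppMeasure_ne_top ((PlaneData.mixedRow q (a 0) (a 2)).withTransportedTorus g g' hgg' hg'g hgΩ) νf νf' (γ₀ : GA ((PlaneData.mixedRow q (a 0) (a 2)).withTransportedTorus g g' hgg' hg'g hgΩ)) ((torusFinSplit ((PlaneData.mixedRow q (a 0) (a 2)).withTransportedTorus g g' hgg' hg'g hgΩ) (placesAbove (k := k) p)) ⁻¹' (Set.univ ×ˢ DA)) hDZc (hpM M) hprop)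
  -- the archimedean test of record (ARCHAPPROX through the K-type data `D`)
  obtain ⟨e, he, hequiv, harch⟩ := exists_infFactor_of_isArchCoeff ((PlaneData.mixedRow q (a 0) (a 2)).withTransportedTorus g g' hgg' hg'g hgΩ)
    (Setting.ofAdelicData ((PlaneData.mixedRow q (a 0) (a 2)).withTransportedTorus g g' hgg' hg'g hgΩ) R μ DG fdG compG compT compT') R q g g' w₀ eP eM eP' eM' (γ₀ : GA ((PlaneData.mixedRow q (a 0) (a 2)).withTransportedTorus g g' hgg' hg'g hgΩ)) νinf νinf'
    hfinf.toIsArchCoeff D μinf hc hu hc' hu'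
  have hchainM := hchain finf hfinf e he hequiv harch
  -- (S-SPARSE) by name (TailSeesawSparse)
  obtain ⟨gth, hg, hR⟩ := exists_sparsityScale_plain q ht hn a ha g g' hgg' hg'g hgΩ lam hlam hiso R μ DG fdG compG compT
    compT' hgen γ₀ hlin p hp μ₀ finf e
  -- (S-FIN-NV) in norm form by name (L4-x2's `finnv_of_displays'`)
  have hnv := finnv_of_displays' ((PlaneData.mixedRow q (a 0) (a 2)).withTransportedTorus g g' hgg' hg'g hgΩ) R hc hu hc' hu' hdet hgen γ₀ hlin p hp.ne_zero νf νf' νA νA' DA hDA hfd hDZc haway hv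
    (fun M => (hchainM M).hIfin) (fun M => (hchainM M).hB)
  -- the plane-structure clauses of (S-RATIO) from the genuine row
  obtain ⟨⟨d, hΩ, hd⟩, hΩB, hPB, hQB, hPr, hQr⟩ := id hgen
  exact exists_levelFamily_fibreDominated_of_ratio ((PlaneData.mixedRow q (a 0) (a 2)).withTransportedTorus g g' hgg' hg'g hgΩ) R μ DG fdG compG compT compT' hRH hc hu hc' hu' q g g' w₀ eP eM eP'
    eM' hdet hgen hΩ hd hΩB hPB hQB hPr hQr γ₀ hreg hlin νinf νf c hc0 hcμ νinf' νf' c' hc0' hcμ' _ hDZf hfd hDZc μinf μ₀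
    c₀ hc₀ hcμ₀ finf hfinf he hequiv harch p hp hγ₀ νS νA cq hcq hZ hv hcount gth hg hR hnv hchainM

end Ratio

end Summit.Ventures.HodgeRepro.Tier4.Line4

end
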